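import Mathlib.Data.ZMod.Basic
import Mathlib.RingTheory.UniqueFactorizationDomain.Multiplicity
import Mathlib.Tactic
import HarnessLib

/-!
# BirchSwinnertonDyer — rank ≥ 2 observatory: KERNEL-2DESC-Z2, bit calculus at a split prime over 2

HONEST FRAMING: per-curve certified theorems and census instruments; no claim on BSD in rank ≥ 2.

Generic layer of the KERNEL-2DESC-Z2 instrument (design `b2b-bsdr2-cert-3/KERNEL-TRANSPORT.md`
§ KERNEL-2DESC-Z2; `code/b2b-bsdr2-cert-3/kernel-2desc-z2/README-Z2.md`). Companion of
`Rank2Observatory2DescZ2SplitOdd`: at a degree-one prime `𝔭 = (π)` of `R = 𝓞 K` over `2 = π·π'`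
(`K_𝔭 = ℚ₂`), the class of `α ∈ R ∖ 0` in `ℚ₂ˣ/ℚ₂ˣ² ≅ ℤ/2 × (ℤ/8)ˣ` is `(k mod 2, res β)` for any
presentation `α = π^k·β` with `res β` ODD, where `res : R →+* ℤ/8` is the residue map modulo `𝔭³`
(certificate: `res π` even, `res π'` odd, `res β` even ⇒ `π ∣ β`). Oddness is phrased `u² = 1`
(true exactly for the units of `ℤ/8`), which makes every `ℤ/8` fact used here a `decide`.
Calculus: existence / uniqueness / products / rational integers / squares (`res βα = res βz` along
`α·z = γ²`), and the POINT LEMMA of the `μ_θ` descent by the conjugate trick (`pres_point_deep₂`: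
for `A` odd, the bits of a deep `n − eθ` are those of `n` times the residue of `A + 2t₈`).

Sorry-free; axioms `propext`, `Classical.choice`, `Quot.sound`. [folklore];
[cite: Cassels1991LecturesEllipticCurves, §15].
-/

-- single-conjunct summit: `Summit.BirchSwinnertonDyer.BirchSwinnertonDyer.…` repeats the name by design
set_option linter.dupNamespace false

noncomputable section

open scoped Classical

namespace Summit.BirchSwinnertonDyer.BirchSwinnertonDyer.Rank2Observatory.TwoDescZ2

/-! ## Arithmetic of `ℤ/8` (all by `decide`) -/

/-- Units of `ZMod 8` square to `1` (by `decide`). [folklore] -/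
theorem zmod8_sq_eq_one_of_mul_eq_one : ∀ a b : ZMod 8, a * b = 1 → a ^ 2 = 1 := by decide

/-- A non-unit of `ZMod 8` times anything is a non-unit: `a ^ 2 ≠ 1 → (a * c) ^ 2 ≠ 1` (by `decide`). [folklore] -/
theorem zmod8_mul_sq_ne_one : ∀ a c : ZMod 8, a ^ 2 ≠ 1 → (a * c) ^ 2 ≠ 1 := by decide

/-- Units of `ZMod 8` are closed under multiplication (by `decide`). [folklore] -/
theorem zmod8_mul_sq_eq_one : ∀ a b : ZMod 8, a ^ 2 = 1 → b ^ 2 = 1 → (a * b) ^ 2 = 1 := by decide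

/-- In `ZMod 8`: if `b` and `c` are units and `a * b = c ^ 2` then `a = b` (unit squares are `1`; by `decide`). [folklore] -/
theorem zmod8_eq_of_mul_eq_sq : ∀ a b c : ZMod 8, b ^ 2 = 1 → c ^ 2 = 1 → a * b = c ^ 2 → a = b := by
  decide

/-- An odd integer squares to `1` in `ZMod 8`. [folklore] -/
theorem zmod8_intCast_sq_eq_one {r : ℤ} (hr : ¬ (2 : ℤ) ∣ r) : ((r : ZMod 8)) ^ 2 = 1 := by
  have h8 : (r : ZMod 8) = ((r % 8 : ℤ) : ZMod 8) := by
    rw [← ZMod.intCast_mod r 8]; norm_num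
  have hlt : r % 8 < 8 := Int.emod_lt_of_pos r (by norm_num)
  have hge : 0 ≤ r % 8 := Int.emod_nonneg r (by norm_num)
  have hodd : r % 8 % 2 = 1 := by omega
  rw [h8]
  interval_cases h : (r % 8) <;> simp_all <;> decide

/-! ## Split-prime data over `2` and presentations -/

variable {R : Type*} [CommRing R]

/-- **A degree-one prime of `R` over `2`**, by certificate: `2 = π·π'`, a residue map
`res : R → ℤ/8` (reduction modulo `𝔭³`) with `res π` even, `res π'` odd, and `res β` even only for
multiples of `π`. A PRESENTATION of `α ≠ 0` is `α = π^k·β` with `res β` odd (`(res β)² = 1`); the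
class of `α` in `ℚ₂ˣ/ℚ₂ˣ²` is `(k mod 2, res β)`. [folklore] -/
structure SplitTwo (R : Type*) [CommRing R] where
  /-- generator of the prime `𝔭` over `2` -/
  π : R
  /-- the cofactor `2 / π` -/
  π' : R
  /-- the residue map `R → R/𝔭³ = ℤ/8` -/
  res : R →+* ZMod 8
  h2 : (2 : R) = π * π'
  hπ : res π ^ 2 ≠ 1
  hπ' : res π' ^ 2 = 1
  hker : ∀ β : R, res β ^ 2 ≠ 1 → π ∣ β

variable (d : SplitTwo R)

/-- The uniformiser `π` of a split-prime-over-`2` datum is not a unit. [folklore] -/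
theorem SplitTwo.not_isUnit : ¬ IsUnit d.π := by
  intro hu
  obtain ⟨v, hv⟩ := hu.exists_right_inv
  have h1 : d.res d.π * d.res v = 1 := by rw [← map_mul, hv, map_one]
  exact d.hπ (zmod8_sq_eq_one_of_mul_eq_one _ _ h1)

/-- The uniformiser `π` of a split-prime-over-`2` datum is nonzero. [folklore] -/
theorem SplitTwo.pi_ne_zero [CharZero R] : d.π ≠ 0 := by
  intro h
  have h1 : (2 : R) = 0 := by rw [d.h2, h, zero_mul]
  exact two_ne_zero h1

/-- Multiples of `π` have a non-unit residue mod `8` (`res β ^ 2 ≠ 1`). [folklore] -/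
theorem SplitTwo.res_sq_ne_one_of_dvd {β : R} (h : d.π ∣ β) : d.res β ^ 2 ≠ 1 := by
  obtain ⟨γ, rfl⟩ := h
  rw [map_mul]
  exact zmod8_mul_sq_ne_one _ _ d.hπ

variable {d}

/-- **Existence** of a presentation of every nonzero element. [folklore] -/
theorem exists_pres₂ [WfDvdMonoid R] {α : R} (hα : α ≠ 0) :
    ∃ (k : ℕ) (β : R), α = d.π ^ k * β ∧ d.res β ^ 2 = 1 := by
  obtain ⟨k, β, hndvd, rfl⟩ := WfDvdMonoid.max_power_factor' hα d.not_isUnit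
  refine ⟨k, β, rfl, ?_⟩
  by_contra h
  exact hndvd (d.hker β h)

/-- An element with a presentation `α = π ^ k * β`, `res β` a unit mod `8`, is nonzero. [folklore] -/
theorem ne_zero_of_pres₂ [CharZero R] [IsDomain R] {α β : R} {k : ℕ} (hα : α = d.π ^ k * β)
    (hβ : d.res β ^ 2 = 1) : α ≠ 0 := by
  rw [hα]
  refine mul_ne_zero (pow_ne_zero _ d.pi_ne_zero) ?_
  rintro rfl
  rw [map_zero] at hβ
  revert hβ
  decide

/-- **Uniqueness** of the presentation. [folklore] -/
theorem pres_unique₂ [CharZero R] [IsDomain R] {α β β' : R} {k k' : ℕ} (hα : α = d.π ^ k * β)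
    (hβ : d.res β ^ 2 = 1) (hα' : α = d.π ^ k' * β') (hβ' : d.res β' ^ 2 = 1) :
    k = k' ∧ β = β' := by
  suffices key : ∀ {β β' : R} {k k' : ℕ}, α = d.π ^ k * β → d.res β ^ 2 = 1 → α = d.π ^ k' * β' →
      d.res β' ^ 2 = 1 → k ≤ k' → k = k' ∧ β = β' by
    rcases le_total k k' with hle | hle
    · exact key hα hβ hα' hβ' hle
    · obtain ⟨h1, h2⟩ := key hα' hβ' hα hβ hle
      exact ⟨h1.symm, h2.symm⟩
  intro β β' k k' hα hβ hα' hβ' hle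
  obtain ⟨j, rfl⟩ := Nat.exists_eq_add_of_le hle
  have hββ' : β = d.π ^ j * β' := by
    have h1 : d.π ^ k * β = d.π ^ k * (d.π ^ j * β') := by rw [← mul_assoc, ← pow_add, ← hα', hα]
    exact mul_left_cancel₀ (pow_ne_zero _ d.pi_ne_zero) h1
  rcases Nat.eq_zero_or_pos j with hj | hj
  · subst hj
    rw [pow_zero, one_mul] at hββ'
    exact ⟨by simp, hββ'⟩
  · exfalso
    apply d.res_sq_ne_one_of_dvd (β := β) _ hβ
    rw [hββ']
    exact dvd_mul_of_dvd_left (dvd_pow_self _ hj.ne') _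

/-- **Products** of presentations. [folklore] -/
theorem pres_mul₂ {α α' β β' : R} {k k' : ℕ} (hα : α = d.π ^ k * β) (hα' : α' = d.π ^ k' * β') :
    α * α' = d.π ^ (k + k') * (β * β') := by
  rw [hα, hα', pow_add]; ring

/-- Unit residues mod `8` are closed under multiplication. [folklore] -/
theorem res_mul_odd {β β' : R} (hβ : d.res β ^ 2 = 1) (hβ' : d.res β' ^ 2 = 1) :
    d.res (β * β') ^ 2 = 1 := by
  rw [map_mul]; exact zmod8_mul_sq_eq_one _ _ hβ hβ'

/-- **Rational integers**: `r = 2^v·r₀`, `r₀` odd, presents as `π^v · (π'^v r₀)` with odd residue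
`res(π')^v · r₀` (the `π'`-correction of the rational 2-adic class). [folklore] -/
theorem pres_intCast₂ {r r₀ : ℤ} {v : ℕ} (hr : r = (2 : ℤ) ^ v * r₀) (h0 : ¬ (2 : ℤ) ∣ r₀) :
    (r : R) = d.π ^ v * (d.π' ^ v * (r₀ : R)) ∧
      d.res (d.π' ^ v * (r₀ : R)) = d.res d.π' ^ v * (r₀ : ZMod 8) ∧
        (d.res d.π' ^ v * (r₀ : ZMod 8)) ^ 2 = 1 := by
  refine ⟨?_, by rw [map_mul, map_pow, map_intCast], ?_⟩
  · rw [hr]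
    push_cast
    rw [d.h2, mul_pow]
    ring
  · have h1 : (d.res d.π' ^ v) ^ 2 = 1 := by rw [← pow_mul, mul_comm, pow_mul, d.hπ', one_pow]
    exact zmod8_mul_sq_eq_one _ _ h1 (zmod8_intCast_sq_eq_one h0)

/-- **Bits along a square relation**: if `α·z = γ²` then the presentations of `α` and `z` have the
same parity and the SAME odd residue mod `8`. [folklore] -/
theorem bits_eq_of_mul_eq_sq₂ [CharZero R] [IsDomain R] [WfDvdMonoid R] {α z γ βα βz : R}
    {kα kz : ℕ} (hα : α = d.π ^ kα * βα) (hβα : d.res βα ^ 2 = 1) (hz : z = d.π ^ kz * βz)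
    (hβz : d.res βz ^ 2 = 1) (h : α * z = γ ^ 2) :
    (kα : ZMod 2) = kz ∧ d.res βα = d.res βz := by
  have hγ0 : γ ≠ 0 := by
    intro h0
    rw [h0, zero_pow two_ne_zero] at h
    rcases mul_eq_zero.mp h with h1 | h1
    · exact ne_zero_of_pres₂ hα hβα h1
    · exact ne_zero_of_pres₂ hz hβz h1
  obtain ⟨kγ, βγ, hγ, hβγ⟩ := exists_pres₂ (d := d) hγ0
  have h1 : α * z = d.π ^ (kα + kz) * (βα * βz) := pres_mul₂ hα hz
  have h2 : γ ^ 2 = d.π ^ (kγ + kγ) * (βγ * βγ) := by rw [sq]; exact pres_mul₂ hγ hγ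
  rw [h] at h1
  obtain ⟨hk, hb⟩ := pres_unique₂ h1 (res_mul_odd hβα hβz) h2 (res_mul_odd hβγ hβγ)
  have hb' : d.res βα * d.res βz = d.res βγ ^ 2 := by rw [← map_mul, hb, map_mul, sq]
  constructor
  · have h3 : ((kα + kz : ℕ) : ZMod 2) = ((kγ + kγ : ℕ) : ZMod 2) := by rw [hk]
    push_cast at h3
    rw [← two_mul, show (2 : ZMod 2) = 0 from rfl, zero_mul] at h3
    have h4 : (kα : ZMod 2) = -kz := eq_neg_of_add_eq_zero_left h3
    rw [h4, ZMod.neg_eq_self_mod_two]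
  · exact zmod8_eq_of_mul_eq_sq _ _ _ hβz hβγ hb'

/-! ## The point lemma of the `μ_θ` descent at a split prime over `2` -/

/-! ## The class map `bitsAt₂` -/

/-- Coordinates of an odd residue mod `8` in `(ℤ/8)ˣ ≅ (ℤ/2)²`: `1 ↦ (0,0)`, `3 ↦ (1,0)`, `5 ↦ (0,1)`,
`7 ↦ (1,1)` (first bit: `≡ 3 mod 4`; second bit: `≡ 5, 7 mod 8`). -/
def bits8 (u : ZMod 8) : ZMod 2 × ZMod 2 :=
  (if u = 3 ∨ u = 7 then 1 else 0, if u = 5 ∨ u = 7 then 1 else 0)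

/-- `bits8` is additive on the units of `ZMod 8` (by `decide`). [folklore] -/
theorem bits8_mul : ∀ a b : ZMod 8, a ^ 2 = 1 → b ^ 2 = 1 → bits8 (a * b) = bits8 a + bits8 b := by
  decide

/-- `bits8` is injective on the units of `ZMod 8` (by `decide`). [folklore] -/
theorem bits8_inj : ∀ a b : ZMod 8, a ^ 2 = 1 → b ^ 2 = 1 → bits8 a = bits8 b → a = b := by
  decide

/-- `bits8 1 = 0` (by `decide`). [folklore] -/
theorem bits8_one : bits8 1 = 0 := by decide

/-- **The class of `α ≠ 0` at the split prime `d` over `2`**: `(k mod 2, bits8 (res β))` for any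
presentation `α = π^k·β` with odd residue (well defined by `pres_unique₂`); `0 ↦ 0`. This is the
coordinate of `α` in `ℚ₂ˣ/ℚ₂ˣ² ≅ (ℤ/2)³` used by the row functionals. [folklore] -/
noncomputable def bitsAt₂ [WfDvdMonoid R] (d : SplitTwo R) (α : R) : ZMod 2 × ZMod 2 × ZMod 2 :=
  if hα : α = 0 then 0 else
    (((Classical.choose (exists_pres₂ (d := d) hα) : ℕ) : ZMod 2),
      bits8 (d.res (Classical.choose (Classical.choose_spec (exists_pres₂ (d := d) hα)))))

/-- `bitsAt₂ d 0 = 0` (the junk value at `0`). [folklore] -/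
theorem bitsAt₂_zero [WfDvdMonoid R] : bitsAt₂ d 0 = 0 := by
  rw [bitsAt₂, dif_pos rfl]

/-- `bitsAt₂` is computed by ANY presentation. [folklore] -/
theorem bitsAt₂_eq [CharZero R] [IsDomain R] [WfDvdMonoid R] {α β : R} {k : ℕ}
    (hα : α = d.π ^ k * β) (hβ : d.res β ^ 2 = 1) :
    bitsAt₂ d α = ((k : ZMod 2), bits8 (d.res β)) := by
  have hα0 : α ≠ 0 := ne_zero_of_pres₂ hα hβ
  rw [bitsAt₂, dif_neg hα0]
  obtain ⟨h1, h2⟩ := pres_unique₂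
    (Classical.choose_spec (Classical.choose_spec (exists_pres₂ (d := d) hα0))).1
    (Classical.choose_spec (Classical.choose_spec (exists_pres₂ (d := d) hα0))).2 hα hβ
  rw [h2, h1]

/-- `bitsAt₂` is additive on products of non-zero elements. [folklore] -/
theorem bitsAt₂_mul [CharZero R] [IsDomain R] [WfDvdMonoid R] {α α' : R} (hα : α ≠ 0)
    (hα' : α' ≠ 0) : bitsAt₂ d (α * α') = bitsAt₂ d α + bitsAt₂ d α' := by
  obtain ⟨k, β, h1, h2⟩ := exists_pres₂ (d := d) hα
  obtain ⟨k', β', h1', h2'⟩ := exists_pres₂ (d := d) hα'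
  rw [bitsAt₂_eq (pres_mul₂ h1 h1') (res_mul_odd h2 h2'), bitsAt₂_eq h1 h2, bitsAt₂_eq h1' h2',
    map_mul, bits8_mul _ _ h2 h2']
  simp

/-- Every element of `ZMod 2 × ZMod 2 × ZMod 2` is `2`-torsion. [folklore] -/
theorem zmod2_triple_add_self (b : ZMod 2 × ZMod 2 × ZMod 2) : b + b = 0 := by
  obtain ⟨b₁, b₂, b₃⟩ := b
  simp only [Prod.mk_add_mk, Prod.mk_eq_zero]
  refine ⟨?_, ?_, ?_⟩
  · fin_cases b₁ <;> decide
  · fin_cases b₂ <;> decide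
  · fin_cases b₃ <;> decide

/-- Squares have trivial class. [folklore] -/
theorem bitsAt₂_sq [CharZero R] [IsDomain R] [WfDvdMonoid R] {γ : R} (hγ : γ ≠ 0) :
    bitsAt₂ d (γ ^ 2) = 0 := by
  rw [sq, bitsAt₂_mul hγ hγ, zmod2_triple_add_self]

/-- **Classes along a square relation**: `α · w = γ²` (all non-zero) gives
`bitsAt₂ α = bitsAt₂ w`. [folklore] -/
theorem bitsAt₂_eq_of_mul_eq_sq [CharZero R] [IsDomain R] [WfDvdMonoid R] {α w γ : R}
    (hα : α ≠ 0) (hw : w ≠ 0) (h : α * w = γ ^ 2) : bitsAt₂ d α = bitsAt₂ d w := by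
  have hγ : γ ≠ 0 := by
    rintro rfl
    rw [zero_pow two_ne_zero] at h
    rcases mul_eq_zero.mp h with h1 | h1
    · exact hα h1
    · exact hw h1
  have h1 : bitsAt₂ d α + bitsAt₂ d w = 0 := by rw [← bitsAt₂_mul hα hw, h, bitsAt₂_sq hγ]
  have h2 : bitsAt₂ d α = -bitsAt₂ d w := eq_neg_of_add_eq_zero_left h1
  rw [h2, neg_eq_iff_add_eq_zero, zmod2_triple_add_self]

/-- **The three-term relation** of the descent at `2`: `n · α · ᾱ = m²` (all non-zero) gives
`bitsAt₂ n + bitsAt₂ α + bitsAt₂ ᾱ = 0`. [folklore] -/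
theorem bitsAt₂_add_add_eq_zero [CharZero R] [IsDomain R] [WfDvdMonoid R] {z α α' γ : R}
    (hz : z ≠ 0) (hα : α ≠ 0) (hα' : α' ≠ 0) (h : z * α * α' = γ ^ 2) :
    bitsAt₂ d z + bitsAt₂ d α + bitsAt₂ d α' = 0 := by
  have hγ : γ ≠ 0 := by
    rintro rfl
    rw [zero_pow two_ne_zero] at h
    rcases mul_eq_zero.mp h with h1 | h1
    · rcases mul_eq_zero.mp h1 with h2 | h2
      · exact hz h2
      · exact hα h2
    · exact hα' h1
  rw [← bitsAt₂_mul hz hα, ← bitsAt₂_mul (mul_ne_zero hz hα) hα', h, bitsAt₂_sq hγ]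

/-- Class of a rational integer `r = 2^v r₀`, `r₀` odd: `(v, bits8 (res(π')^v · r₀))`. [folklore] -/
theorem bitsAt₂_intCast [CharZero R] [IsDomain R] [WfDvdMonoid R] {r r₀ : ℤ} {v : ℕ}
    (hr : r = (2 : ℤ) ^ v * r₀) (h0 : ¬ (2 : ℤ) ∣ r₀) :
    bitsAt₂ d (r : R) = ((v : ZMod 2), bits8 (d.res d.π' ^ v * (r₀ : ZMod 8))) := by
  obtain ⟨h1, h2, h3⟩ := pres_intCast₂ (d := d) (R := R) hr h0
  rw [bitsAt₂_eq h1 (by rw [h2]; exact h3), h2]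

variable {θ : R} {A B : ℤ} {t₈ : ZMod 8}

omit [CommRing R] in
/-- The conjugate identity `(n − eθ)(n + eA + eθ) = n² + A n e + B e²` for `θ² + Aθ + B = 0`.
[folklore] -/
theorem mul_conj_eq_normForm₂ [CommRing R] (hq : θ ^ 2 + (A : R) * θ + (B : R) = 0) (n e : ℤ) :
    ((n : R) - (e : R) * θ) * ((n : R) + (e : R) * (A : R) + (e : R) * θ) =
      ((n ^ 2 + A * n * e + B * e ^ 2 : ℤ) : R) := by
  push_cast
  linear_combination (-(e : R) ^ 2) * hq

/-- Residue of `n − eθ` modulo `𝔭³`. [folklore] -/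
theorem res_point₂ (ht : d.res θ = t₈) (n e : ℤ) :
    d.res ((n : R) - (e : R) * θ) = (n : ZMod 8) - (e : ZMod 8) * t₈ := by
  rw [map_sub, map_mul, map_intCast, map_intCast, ht]

/-- **Point lemma, shallow case**: if `n − e·t₈` is odd then `n − eθ = π⁰·(n − eθ)` is its own
presentation, with residue `n − e t₈ (mod 8)`. [folklore] -/
theorem pres_point_shallow₂ (ht : d.res θ = t₈) {n e : ℤ}
    (hA : ((n : ZMod 8) - (e : ZMod 8) * t₈) ^ 2 = 1) :
    (n : R) - (e : R) * θ = d.π ^ 0 * ((n : R) - (e : R) * θ) ∧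
      d.res ((n : R) - (e : R) * θ) ^ 2 = 1 := by
  refine ⟨by rw [pow_zero, one_mul], ?_⟩
  rw [res_point₂ ht]; exact hA

/-- **Point lemma, deep case** (the conjugate trick over `2`). Integral form of a rational point:
`m² = n(n² + A n e + B e²)` with `e = d₀²` ODD, `α = n − eθ ≠ 0` of EVEN residue, `A` odd (then the
conjugate `n + eA + eθ = α + e(A + 2θ)` has odd residue), and a presentation `n = π^k·βn`. Then `α`
presents as `π^k'·β'` with `k' ≡ k (mod 2)` and `res β' = res βn · (res ᾱ)`, where
`res ᾱ = n + eA + e t₈`: from `α · ᾱ · n = m²`. [cite: Cassels1991LecturesEllipticCurves, §15] -/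
theorem pres_point_deep₂ [CharZero R] [IsDomain R] [WfDvdMonoid R]
    (hq : θ ^ 2 + (A : R) * θ + (B : R) = 0) (ht : d.res θ = t₈)
    {n e m : ℤ} (hE : m ^ 2 = n * (n ^ 2 + A * n * e + B * e ^ 2))
    (hodd : ((n : ZMod 8) + (e : ZMod 8) * (A : ZMod 8) + (e : ZMod 8) * t₈) ^ 2 = 1)
    (hα : (n : R) - (e : R) * θ ≠ 0) {k : ℕ} {βn : R} (hn : (n : R) = d.π ^ k * βn)
    (hβn : d.res βn ^ 2 = 1) :
    ∃ (k' : ℕ) (β' : R), (n : R) - (e : R) * θ = d.π ^ k' * β' ∧ d.res β' ^ 2 = 1 ∧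
      (k' : ZMod 2) = k ∧
        d.res β' = d.res βn * ((n : ZMod 8) + (e : ZMod 8) * (A : ZMod 8) + (e : ZMod 8) * t₈) := by
  set α : R := (n : R) - (e : R) * θ with hαdef
  set αb : R := (n : R) + (e : R) * (A : R) + (e : R) * θ with hαbdef
  have hresb : d.res αb = (n : ZMod 8) + (e : ZMod 8) * (A : ZMod 8) + (e : ZMod 8) * t₈ := by
    rw [hαbdef, map_add, map_add, map_mul, map_mul, map_intCast, map_intCast, map_intCast, ht]
  have hb1 : d.res αb ^ 2 = 1 := by rw [hresb]; exact hodd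
  have hpb : αb = d.π ^ 0 * αb := by rw [pow_zero, one_mul]
  obtain ⟨kα, βα, hpα, hβα⟩ := exists_pres₂ (d := d) hα
  have hprod : α * αb * (n : R) = ((m : R)) ^ 2 := by
    have h1 : α * αb = ((n ^ 2 + A * n * e + B * e ^ 2 : ℤ) : R) := mul_conj_eq_normForm₂ hq n e
    rw [h1, ← Int.cast_mul, ← Int.cast_pow, hE]
    push_cast
    ring
  have hpαb : α * αb = d.π ^ (kα + 0) * (βα * αb) := pres_mul₂ hpα hpb
  obtain ⟨hk, hc⟩ := bits_eq_of_mul_eq_sq₂ hpαb (res_mul_odd hβα hb1) hn hβn hprod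
  refine ⟨kα, βα, hpα, hβα, by simpa using hk, ?_⟩
  -- `res βα · res αb = res βn` and `res αb² = 1` ⇒ `res βα = res βn · res αb`
  rw [map_mul] at hc
  rw [← hresb]
  calc d.res βα = d.res βα * (d.res αb ^ 2) := by rw [hb1, mul_one]
    _ = d.res βα * d.res αb * d.res αb := by ring
    _ = d.res βn * d.res αb := by rw [hc]

end Summit.BirchSwinnertonDyer.BirchSwinnertonDyer.Rank2Observatory.TwoDescZ2

end
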